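import Summits.AtomisticToContinuum.BoseEinsteinCondensation.Theorems.BECHardSphereReductionHardCoreDominatesTransferSchema
import Summits.AtomisticToContinuum.BoseEinsteinCondensation.Theorems.BECHardSphereReductionHardCoreDominatesMaxOccupationStability
import Summits.AtomisticToContinuum.BoseEinsteinCondensation.Theorems.BECHardSphereReductionHardCoreDominatesDirichletRellich
import Summits.AtomisticToContinuum.BoseEinsteinCondensation.Theorems.BECHardSphereReductionHardCoreDominatesHardSphereClosedEnergy
import Summits.AtomisticToContinuum.BoseEinsteinCondensation.Theorems.BECHardSphereReductionHardCoreDominatesCutToHardCoreOf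
import HarnessLib

/-!
# Lower semicontinuity of the ground-state condensate number at the hard core
# (stub `stub_continuityAtHardCore` of line `birth`, crux `BECHardSphereReduction.HardCoreDominates`,
# stmt-AtomisticToContinuum-11884)

Along the coupling path `v_t := v + t·1_{Iic R}` (`t : ℝ≥0`) of a measurable radial profile `v` vanishing beyond
`R > 0`, the hard-sphere profile `HS_R := ⊤·1_{Iic R}` is the `t = ∞` endpoint, and at EVERY fixed `(N, L)`

  `condensateNumber HS_R N L ≤ liminf_{t → ∞} condensateNumber v_t N L`.

This is the planner's stub 2 of the line exactly as filed (with its dilute guard `N·R³ ≤ η₀·L³`, which is not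
needed: `η₀ := 1`). It is ASSEMBLED here from the five landed pieces of the lead's reshaped skeleton:
the order-theoretic transfer schema (`stub_transferSchema`), Rellich compactness of bounded-kinetic-energy
Dirichlet trial states (`stub_dirichletRellich`), the closed-energy identity at the hard core
(`stub_hardSphereClosedEnergy`, maximal form = minimal form), the compactness glue (`stub_cutToHardCore_of`) and
the `L²`-stability of `λ_max(γ_Ψ)` (`stub_maxOccupationStability`). Mechanism: near-minimisers of `v_t` for large
`t` are `L²`-close to hard-sphere near-minimisers of any prescribed slack, and `λ_max` moves by at most
`2N‖Φ − Ψ‖₂`. [folklore]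
-/

noncomputable section

namespace Summit.AtomisticToContinuum.BoseEinsteinCondensation.Cruxes.HardCoreDominates.Birth

open Literature.MathematicalPhysics.QuantumManyBody.BoseGas

/-- `(x ^ 2) ^ (1/2) = x` in `ℝ≥0∞`. [folklore] -/
theorem ennreal_sq_rpow_half (x : ENNReal) : (x ^ 2) ^ (1 / 2 : ℝ) = x := by
  rw [← ENNReal.rpow_natCast, ← ENNReal.rpow_mul]
  norm_num

/-- **Lower semicontinuity of `condensateNumber` at the hard core, every `N, L`** (no dilute guard):
`condensateNumber HS_R N L ≤ liminf_{t→∞} condensateNumber (v + t·1_{Iic R}) N L`. [folklore] -/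
theorem condensateNumber_hardSphere_le_liminf (v : ℝ → ENNReal) (R : ℝ) (hmeas : Measurable v)
    (hR : 0 < R) (hvR : ∀ r : ℝ, R < r → v r = 0) (N : ℕ) (L : ℝ) :
    condensateNumber (Set.indicator (Set.Iic R) (fun _ : ℝ => (⊤ : ENNReal))) N L ≤
      Filter.liminf (fun t : NNReal =>
        condensateNumber (v + Set.indicator (Set.Iic R) (fun _ : ℝ => (t : ENNReal))) N L) Filter.atTop := by
  refine stub_transferSchema v R N L fun δ hδ η hη => ?_
  -- occupation error `η` ⇐ `L²`-distance `ε` with `2N √ε ≤ η`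
  set ε : ENNReal := (η / (2 * (N : ENNReal) + 1)) ^ 2 with hε
  have hden : (2 * (N : ENNReal) + 1) ≠ ⊤ :=
    ENNReal.add_ne_top.2 ⟨ENNReal.mul_ne_top (by norm_num) (ENNReal.natCast_ne_top N),
      ENNReal.one_ne_top⟩
  have hden0 : (2 * (N : ENNReal) + 1) ≠ 0 := by positivity
  have hεpos : 0 < ε := by
    rw [hε]
    exact ENNReal.pow_pos (ENNReal.div_pos hη.ne' hden) 2
  have hεη : 2 * (N : ENNReal) * ε ^ (1 / 2 : ℝ) ≤ η := by
    rw [hε, ennreal_sq_rpow_half]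
    calc 2 * (N : ENNReal) * (η / (2 * (N : ENNReal) + 1))
        ≤ (2 * (N : ENNReal) + 1) * (η / (2 * (N : ENNReal) + 1)) := by
          gcongr
          exact le_self_add
      _ = η := ENNReal.mul_div_cancel hden0 hden
  obtain ⟨T, hT⟩ := stub_cutToHardCore_of stub_dirichletRellich stub_hardSphereClosedEnergy v R hmeas hR
    hvR N L δ hδ ε hεpos
  refine ⟨T, fun t ht => ?_⟩
  obtain ⟨δ', hδ', hΨ⟩ := hT t ht
  refine ⟨δ', hδ', fun Ψ hE => ?_⟩
  obtain ⟨Φ, hΦE, hdist⟩ := hΨ Ψ hE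
  refine ⟨Φ, hΦE, (stub_maxOccupationStability N L Φ Ψ).trans ?_⟩
  gcongr ?_ + ?_
  · exact le_rfl
  · refine le_trans ?_ hεη
    gcongr

/-- **Stub `stub_continuityAtHardCore` of line `birth` (as filed by the planner, dilute guard included):**
for every measurable radial profile `v` vanishing beyond `R > 0` there is a dilute window `N·R³ ≤ η₀·L³`
(`η₀ := 1` works — the guard is idle) in which `condensateNumber HS_R N L ≤
liminf_{t → ∞} condensateNumber (v + t·1_{Iic R}) N L`. [folklore] -/
theorem stub_continuityAtHardCore :
    ∀ (v : ℝ → ENNReal) (R : ℝ), Measurable v → 0 < R → (∀ r : ℝ, R < r → v r = 0) →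
      ∃ η₀ : ℝ, 0 < η₀ ∧ ∀ (N : ℕ) (L : ℝ), (N : ℝ) * R ^ 3 ≤ η₀ * L ^ 3 →
        Literature.MathematicalPhysics.QuantumManyBody.BoseGas.condensateNumber
            (Set.indicator (Set.Iic R) (fun _ : ℝ => (⊤ : ENNReal))) N L ≤
          Filter.liminf (fun t : NNReal =>
            Literature.MathematicalPhysics.QuantumManyBody.BoseGas.condensateNumber
              (v + Set.indicator (Set.Iic R) (fun _ : ℝ => (t : ENNReal))) N L) Filter.atTop :=
  fun v R hmeas hR hvR => ⟨1, one_pos, fun N L _ => condensateNumber_hardSphere_le_liminf v R hmeas hR hvR N L⟩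

end Summit.AtomisticToContinuum.BoseEinsteinCondensation.Cruxes.HardCoreDominates.Birth

end
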